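import Summits.Parity.GeneralizedHardyLittlewood.Theorems.GreenTaoLevelTwoMNTwoTorusPartition
import Summits.Parity.GeneralizedHardyLittlewood.Theorems.GreenTaoLevelTwoMNTwoBohrGauge

/-!
# Route `GreenTaoLevelTwo`, crux `MNTwo` (stmt-Parity-21276), line `birth`, stub `stub_mnVertical`:
# localizing a gauge-Lipschitz weight to small Bohr pieces (GT 2008b §12)

Block V6 of the `stub_mnVertical` census, localization step (B. Green, T. Tao, *Quadratic uniformity
of the Möbius function*, Ann. Inst. Fourier 58 (2008) = arXiv:math/0606087, §12: "we may cover
`B_g(n₀,ρ₀)` with `O(ε^{-C})` Bohr sets `B_g(n_α,ε)` … This induces a corresponding partition of `ψ`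
into `O(ε^{-C})` functions `ψ_α`, each of which is supported on a Bohr set `B_g(n_α,ε)` and still
obeys the Lipschitz bound").  Explicit, def-free construction with the tents of
`…MNTwoTorusPartition` (the other seat's V3 tool): for a mesh `m`, `a : Fin k → Fin m` and `j`, the
piece is
`P_{a,j}(n) = ψ(n) · ∏ᵢ τ_{aᵢ}(nαᵢ) · τ_j(n/(3N))`  (`τ_j(s) = max(0, 1 − m‖s − j/m‖_{ℝ/ℤ})`;
the factor `n/(3N) ∈ (1/3, 2/3]` keeps the last tent away from the wrap-around point).  In the
gauge `ν(h) = ⨆ᵢ‖hαᵢ‖ + |h|/N` of `…MNTwoBohrGauge` the pieces have the properties required by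
`…MNTwoMajorArcLocal.norm_sum_moebius_major_arc_piece_le`:

* `piece_nonneg_le` — `0 ≤ P ≤ ψ`;
* `piece_diam` — two points of `supp P` (inside `(N,2N]`) are at gauge distance `< 8/m`;
* `piece_shift` — `|P(n+h) − P(n)| ≤ (1 + km + m) ν(h)` for a gauge-`1`-Lipschitz `ψ ≤ 1`;
* `sum_pieces_eq` — `Σ_a Σ_{j<m} P_{a,j}(n) = ψ(n)` (`m ≥ 2`).

References: [GreenTao2008QuadraticMobius] arXiv:math/0606087 §12 (partition of `ψ`).
-/

noncomputable section

open Finset Real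

namespace Summit.Parity.GeneralizedHardyLittlewood.GreenTaoLevelTwoMNTwoLocalPiece

open Summit.Parity.GeneralizedHardyLittlewood.GreenTaoLevelTwoMNTwoTorusPartition
  (tent_nonneg tent_le_one abs_tent_sub_tent_le tent_support sum_tent_eq_one sum_prodTent_eq_one
   abs_prodTent_le_one abs_prodTent_sub_prodTent_le prodTent_support)
open Summit.Parity.GeneralizedHardyLittlewood.GreenTaoLevelTwoMNTwoRotationBohrSize (norm_coe_le_abs')
open Summit.Parity.GeneralizedHardyLittlewood.GreenTaoLevelTwoMNTwoBohrGauge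
  (bddAbove_range_norm iSup_norm_nonneg)

variable {k : ℕ}

/-- The torus factor is in `[0, 1]`. [folklore] -/
theorem prodTent_mem {m : ℕ} (a : Fin k → Fin m) (y : Fin k → ℝ) :
    0 ≤ ∏ i, max 0 (1 - (m : ℝ) * ‖((y i - ((a i : ℕ) : ℝ) / m : ℝ) : AddCircle (1 : ℝ))‖) ∧
      ∏ i, max 0 (1 - (m : ℝ) * ‖((y i - ((a i : ℕ) : ℝ) / m : ℝ) : AddCircle (1 : ℝ))‖) ≤ 1 := by
  have h0 : 0 ≤ ∏ i, max 0 (1 - (m : ℝ) * ‖((y i - ((a i : ℕ) : ℝ) / m : ℝ) : AddCircle (1 : ℝ))‖) :=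
    prod_nonneg fun i _ => tent_nonneg m (a i) (y i)
  refine ⟨h0, ?_⟩
  have := abs_prodTent_le_one k a y
  rwa [abs_of_nonneg h0] at this

/-- **`0 ≤ P ≤ ψ`.** [folklore] -/
theorem piece_nonneg_le {m : ℕ} (α : Fin k → ℝ) (N : ℕ) (ψ : ℤ → ℝ) (hψ0 : ∀ n, 0 ≤ ψ n)
    (a : Fin k → Fin m) (j : ℕ) (n : ℤ) :
    0 ≤ ψ n * (∏ i, max 0 (1 - (m : ℝ) * ‖(((n : ℝ) * α i - ((a i : ℕ) : ℝ) / m : ℝ) : AddCircle (1 : ℝ))‖)) *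
        max 0 (1 - (m : ℝ) * ‖(((n : ℝ) / (3 * N) - (j : ℝ) / m : ℝ) : AddCircle (1 : ℝ))‖) ∧
      ψ n * (∏ i, max 0 (1 - (m : ℝ) * ‖(((n : ℝ) * α i - ((a i : ℕ) : ℝ) / m : ℝ) : AddCircle (1 : ℝ))‖)) *
        max 0 (1 - (m : ℝ) * ‖(((n : ℝ) / (3 * N) - (j : ℝ) / m : ℝ) : AddCircle (1 : ℝ))‖) ≤ ψ n := by
  set χ := ∏ i, max 0 (1 - (m : ℝ) *
    ‖(((n : ℝ) * α i - ((a i : ℕ) : ℝ) / m : ℝ) : AddCircle (1 : ℝ))‖) with hχ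
  set τ := max 0 (1 - (m : ℝ) * ‖(((n : ℝ) / (3 * N) - (j : ℝ) / m : ℝ) : AddCircle (1 : ℝ))‖) with hτ
  have h12 := prodTent_mem a (fun i => (n : ℝ) * α i)
  beta_reduce at h12
  rw [← hχ] at h12
  obtain ⟨h1, h2⟩ := h12
  have h3 : 0 ≤ τ := tent_nonneg m j ((n : ℝ) / (3 * N))
  have h4 : τ ≤ 1 := tent_le_one m j ((n : ℝ) / (3 * N))
  have h5 := hψ0 n
  refine ⟨mul_nonneg (mul_nonneg h5 h1) h3, ?_⟩
  calc ψ n * χ * τ ≤ ψ n * 1 * 1 :=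
        mul_le_mul (mul_le_mul_of_nonneg_left h2 h5) h4 h3 (by rw [mul_one]; exact h5)
    _ = ψ n := by ring

/-- **Gauge diameter of a piece.**  If `P_{a,j}(n) ≠ 0`, `P_{a,j}(n') ≠ 0` and `|n − n'| ≤ N`
(e.g. both in `(N,2N]`), then `ν(n − n') < 8/m`. [cite: GreenTao2008QuadraticMobius, §12] -/
theorem piece_diam {m : ℕ} (hm : 0 < m) (α : Fin k → ℝ) {N : ℕ} (hN : 1 ≤ N) (ψ : ℤ → ℝ)
    (a : Fin k → Fin m) (j : ℕ) {n n' : ℤ} (hnn' : |((n - n' : ℤ) : ℝ)| ≤ N)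
    (hn : ψ n * (∏ i, max 0 (1 - (m : ℝ) *
        ‖(((n : ℝ) * α i - ((a i : ℕ) : ℝ) / m : ℝ) : AddCircle (1 : ℝ))‖)) *
      max 0 (1 - (m : ℝ) * ‖(((n : ℝ) / (3 * N) - (j : ℝ) / m : ℝ) : AddCircle (1 : ℝ))‖) ≠ 0)
    (hn' : ψ n' * (∏ i, max 0 (1 - (m : ℝ) *
        ‖(((n' : ℝ) * α i - ((a i : ℕ) : ℝ) / m : ℝ) : AddCircle (1 : ℝ))‖)) *
      max 0 (1 - (m : ℝ) * ‖(((n' : ℝ) / (3 * N) - (j : ℝ) / m : ℝ) : AddCircle (1 : ℝ))‖) ≠ 0) :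
    (⨆ i : Fin k, ‖((((n - n' : ℤ) : ℝ) * α i : ℝ) : AddCircle (1 : ℝ))‖) +
        |((n - n' : ℤ) : ℝ)| / N < 8 / m := by
  have hmr : (0 : ℝ) < m := by exact_mod_cast hm
  have hNr : (0 : ℝ) < N := by exact_mod_cast hN
  obtain ⟨⟨hψn, hχn⟩, hτn⟩ := mul_ne_zero_iff.1 hn |>.imp (mul_ne_zero_iff.1) id
  obtain ⟨⟨hψn', hχn'⟩, hτn'⟩ := mul_ne_zero_iff.1 hn' |>.imp (mul_ne_zero_iff.1) id
  -- torus coordinates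
  have htor : ∀ i, ‖((((n - n' : ℤ) : ℝ) * α i : ℝ) : AddCircle (1 : ℝ))‖ < 2 / m := by
    intro i
    have h := prodTent_support hm k a hχn hχn' i
    have e : ((n : ℝ) * α i - (n' : ℝ) * α i : ℝ) = ((n - n' : ℤ) : ℝ) * α i := by push_cast; ring
    rwa [e] at h
  have hsup : (⨆ i : Fin k, ‖((((n - n' : ℤ) : ℝ) * α i : ℝ) : AddCircle (1 : ℝ))‖) ≤ 2 / m := by
    refine Real.iSup_le (fun i => (htor i).le) (by positivity)
  -- the `n/(3N)` coordinate: no wrap-around since `|n − n'|/(3N) ≤ 1/3`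
  have hline : |((n - n' : ℤ) : ℝ)| / N < 6 / m := by
    have h := tent_support hm j hτn hτn'
    have e : ((n : ℝ) / (3 * N) - (n' : ℝ) / (3 * N) : ℝ) = ((n - n' : ℤ) : ℝ) / (3 * N) := by
      push_cast; ring
    rw [e] at h
    have hsmall : |((n - n' : ℤ) : ℝ) / (3 * N)| ≤ |(1 : ℝ)| / 2 := by
      rw [abs_div, abs_of_pos (by positivity : (0 : ℝ) < 3 * N), abs_one,
        div_le_div_iff₀ (by positivity) (by norm_num)]
      linarith
    rw [(AddCircle.norm_coe_eq_abs_iff (1 : ℝ) one_ne_zero).2 hsmall, abs_div,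
      abs_of_pos (by positivity : (0 : ℝ) < 3 * N)] at h
    rw [div_lt_div_iff₀ hNr hmr]
    rw [div_lt_div_iff₀ (by positivity) hmr] at h
    linarith
  have : (2 : ℝ) / m + 6 / m = 8 / m := by ring
  linarith

/-- **Shift bound for a piece.**  If `0 ≤ ψ ≤ 1` is gauge-`1`-Lipschitz
(`|ψ(n) − ψ(n')| ≤ ν(n − n')`), then `|P_{a,j}(n+h) − P_{a,j}(n)| ≤ (1 + km + m) ν(h)`.
[cite: GreenTao2008QuadraticMobius, §12] -/
theorem piece_shift {m : ℕ} (α : Fin k → ℝ) {N : ℕ} (hN : 1 ≤ N) (ψ : ℤ → ℝ)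
    (hψ0 : ∀ n, 0 ≤ ψ n) (hψ1 : ∀ n, ψ n ≤ 1)
    (hlip : ∀ n n' : ℤ, |ψ n - ψ n'| ≤
      (⨆ i : Fin k, ‖((((n - n' : ℤ) : ℝ) * α i : ℝ) : AddCircle (1 : ℝ))‖) + |((n - n' : ℤ) : ℝ)| / N)
    (a : Fin k → Fin m) (j : ℕ) (n h : ℤ) :
    |ψ (n + h) * (∏ i, max 0 (1 - (m : ℝ) *
        ‖((((n + h : ℤ) : ℝ) * α i - ((a i : ℕ) : ℝ) / m : ℝ) : AddCircle (1 : ℝ))‖)) *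
        max 0 (1 - (m : ℝ) * ‖((((n + h : ℤ) : ℝ) / (3 * N) - (j : ℝ) / m : ℝ) : AddCircle (1 : ℝ))‖) -
      ψ n * (∏ i, max 0 (1 - (m : ℝ) *
        ‖(((n : ℝ) * α i - ((a i : ℕ) : ℝ) / m : ℝ) : AddCircle (1 : ℝ))‖)) *
        max 0 (1 - (m : ℝ) * ‖(((n : ℝ) / (3 * N) - (j : ℝ) / m : ℝ) : AddCircle (1 : ℝ))‖)| ≤
      (1 + k * m + m) * ((⨆ i : Fin k, ‖(((h : ℝ) * α i : ℝ) : AddCircle (1 : ℝ))‖) + |(h : ℝ)| / N) := by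
  have hNr : (0 : ℝ) < N := by exact_mod_cast hN
  -- abbreviations
  set χ₁ := ∏ i, max 0 (1 - (m : ℝ) *
    ‖((((n + h : ℤ) : ℝ) * α i - ((a i : ℕ) : ℝ) / m : ℝ) : AddCircle (1 : ℝ))‖) with hχ₁
  set χ₀ := ∏ i, max 0 (1 - (m : ℝ) *
    ‖(((n : ℝ) * α i - ((a i : ℕ) : ℝ) / m : ℝ) : AddCircle (1 : ℝ))‖) with hχ₀
  set τ₁ := max 0 (1 - (m : ℝ) * ‖((((n + h : ℤ) : ℝ) / (3 * N) - (j : ℝ) / m : ℝ) : AddCircle (1 : ℝ))‖)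
    with hτ₁
  set τ₀ := max 0 (1 - (m : ℝ) * ‖(((n : ℝ) / (3 * N) - (j : ℝ) / m : ℝ) : AddCircle (1 : ℝ))‖) with hτ₀
  set ν : ℝ := (⨆ i : Fin k, ‖(((h : ℝ) * α i : ℝ) : AddCircle (1 : ℝ))‖) + |(h : ℝ)| / N with hν
  have hsup0 : 0 ≤ ⨆ i : Fin k, ‖(((h : ℝ) * α i : ℝ) : AddCircle (1 : ℝ))‖ := iSup_norm_nonneg α h
  have hν0 : 0 ≤ ν := by rw [hν]; positivity
  have hA := prodTent_mem a (fun i => ((n + h : ℤ) : ℝ) * α i)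
  have hB := prodTent_mem a (fun i => (n : ℝ) * α i)
  beta_reduce at hA hB
  rw [← hχ₁] at hA
  rw [← hχ₀] at hB
  obtain ⟨hχ₁0, hχ₁1⟩ := hA
  obtain ⟨hχ₀0, hχ₀1⟩ := hB
  have hτ₁0 : 0 ≤ τ₁ := tent_nonneg m j _
  have hτ₁1 : τ₁ ≤ 1 := tent_le_one m j _
  have hτ₀0 : 0 ≤ τ₀ := tent_nonneg m j _
  have hτ₀1 : τ₀ ≤ 1 := tent_le_one m j _
  -- the three differences
  have d1 : |ψ (n + h) - ψ n| ≤ ν := by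
    have := hlip (n + h) n
    rwa [show (n + h - n : ℤ) = h by ring] at this
  have d2 : |χ₁ - χ₀| ≤ k * m * ν := by
    have hyy : ∀ i, ‖((((n + h : ℤ) : ℝ) * α i - (n : ℝ) * α i : ℝ) : AddCircle (1 : ℝ))‖ ≤ ν := by
      intro i
      have e : (((n + h : ℤ) : ℝ) * α i - (n : ℝ) * α i : ℝ) = (h : ℝ) * α i := by push_cast; ring
      rw [e, hν]
      have h1 : ‖(((h : ℝ) * α i : ℝ) : AddCircle (1 : ℝ))‖ ≤
          ⨆ i : Fin k, ‖(((h : ℝ) * α i : ℝ) : AddCircle (1 : ℝ))‖ :=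
        le_ciSup (bddAbove_range_norm α h) i
      have h2 : 0 ≤ |(h : ℝ)| / N := by positivity
      linarith
    exact abs_prodTent_sub_prodTent_le k a _ _ ν hν0 hyy
  have d3 : |τ₁ - τ₀| ≤ m * ν := by
    have h1 := abs_tent_sub_tent_le m j (((n + h : ℤ) : ℝ) / (3 * N)) ((n : ℝ) / (3 * N))
    have e : (((n + h : ℤ) : ℝ) / (3 * N) - (n : ℝ) / (3 * N) : ℝ) = (h : ℝ) / (3 * N) := by
      push_cast; ring
    rw [e] at h1
    have h2 : ‖(((h : ℝ) / (3 * N) : ℝ) : AddCircle (1 : ℝ))‖ ≤ ν := by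
      refine (norm_coe_le_abs' _).trans ?_
      rw [abs_div, abs_of_pos (by positivity : (0 : ℝ) < 3 * N), hν]
      have : |(h : ℝ)| / (3 * N) ≤ |(h : ℝ)| / N :=
        div_le_div_of_nonneg_left (abs_nonneg _) hNr (by linarith)
      linarith
    exact h1.trans (mul_le_mul_of_nonneg_left h2 (Nat.cast_nonneg _))
  -- telescoping
  have e : ψ (n + h) * χ₁ * τ₁ - ψ n * χ₀ * τ₀ =
      (ψ (n + h) - ψ n) * χ₁ * τ₁ + ψ n * (χ₁ - χ₀) * τ₁ + ψ n * χ₀ * (τ₁ - τ₀) := by ring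
  rw [e]
  have hψn0 := hψ0 n; have hψn1 := hψ1 n
  calc |(ψ (n + h) - ψ n) * χ₁ * τ₁ + ψ n * (χ₁ - χ₀) * τ₁ + ψ n * χ₀ * (τ₁ - τ₀)|
      ≤ |(ψ (n + h) - ψ n) * χ₁ * τ₁| + |ψ n * (χ₁ - χ₀) * τ₁| + |ψ n * χ₀ * (τ₁ - τ₀)| :=
        abs_add_three _ _ _
    _ ≤ ν + k * m * ν + m * ν := by
        refine add_le_add (add_le_add ?_ ?_) ?_
        · rw [abs_mul, abs_mul, abs_of_nonneg hχ₁0, abs_of_nonneg hτ₁0]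
          calc |ψ (n + h) - ψ n| * χ₁ * τ₁ ≤ ν * 1 * 1 := by
                apply mul_le_mul (mul_le_mul d1 hχ₁1 hχ₁0 hν0) hτ₁1 hτ₁0 (by positivity)
            _ = ν := by ring
        · rw [abs_mul, abs_mul, abs_of_nonneg hψn0, abs_of_nonneg hτ₁0]
          calc ψ n * |χ₁ - χ₀| * τ₁ ≤ 1 * (k * m * ν) * 1 := by
                apply mul_le_mul (mul_le_mul hψn1 d2 (abs_nonneg _) zero_le_one) hτ₁1 hτ₁0
                  (by positivity)
            _ = k * m * ν := by ring
        · rw [abs_mul, abs_mul, abs_of_nonneg hψn0, abs_of_nonneg hχ₀0]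
          calc ψ n * χ₀ * |τ₁ - τ₀| ≤ 1 * 1 * (m * ν) :=
                mul_le_mul (mul_le_mul hψn1 hχ₀1 hχ₀0 zero_le_one) d3 (abs_nonneg _) (by positivity)
            _ = m * ν := by ring
    _ = (1 + k * m + m) * ν := by ring

/-- **The pieces sum to `ψ`** (`m ≥ 2`). [folklore] -/
theorem sum_pieces_eq {m : ℕ} (hm : 2 ≤ m) (α : Fin k → ℝ) (N : ℕ) (ψ : ℤ → ℝ) (n : ℤ) :
    ∑ a : Fin k → Fin m, ∑ j ∈ range m,
      ψ n * (∏ i, max 0 (1 - (m : ℝ) *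
        ‖(((n : ℝ) * α i - ((a i : ℕ) : ℝ) / m : ℝ) : AddCircle (1 : ℝ))‖)) *
        max 0 (1 - (m : ℝ) * ‖(((n : ℝ) / (3 * N) - (j : ℝ) / m : ℝ) : AddCircle (1 : ℝ))‖) = ψ n := by
  have h1 : ∀ a : Fin k → Fin m, ∑ j ∈ range m,
      ψ n * (∏ i, max 0 (1 - (m : ℝ) *
        ‖(((n : ℝ) * α i - ((a i : ℕ) : ℝ) / m : ℝ) : AddCircle (1 : ℝ))‖)) *
        max 0 (1 - (m : ℝ) * ‖(((n : ℝ) / (3 * N) - (j : ℝ) / m : ℝ) : AddCircle (1 : ℝ))‖) =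
      ψ n * (∏ i, max 0 (1 - (m : ℝ) *
        ‖(((n : ℝ) * α i - ((a i : ℕ) : ℝ) / m : ℝ) : AddCircle (1 : ℝ))‖)) := by
    intro a
    rw [← Finset.mul_sum, sum_tent_eq_one hm, mul_one]
  simp_rw [h1]
  rw [← Finset.mul_sum, sum_prodTent_eq_one hm k, mul_one]

end Summit.Parity.GeneralizedHardyLittlewood.GreenTaoLevelTwoMNTwoLocalPiece
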